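import Literature.Geometry.Lorentzian.SecondFundamentalFormApply
import Literature.Geometry.Lorentzian.CauchyProblemProofs
import HarnessLib

/-!
# Normal derivative and second fundamental form along a map into a flat model space

For a pseudo-Riemannian metric `g` with *constant components* `G₀` on a normed space `F`
(regarded as a manifold modelled on itself; `Minkowski.smoothMetric` on `E4`, the flat metric on
`E3`, …) the Levi-Civita connection kills constant fields (`ModelSpace.leviCivita_const`,
`CauchyProblemProofs`: all Christoffel symbols of the natural coordinates vanish; O'Neill 1983,
Ch. 3, Lemma 3.14). Consequently the covariant derivative along a map `f : N → F` of a field `ν`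
along `f` is the ordinary differential of `ν` read as an `F`-valued function, and the second
fundamental form is `K_ν(v, w) = G₀(dν_y v, df_y w)` — the computation used, for a particular
graph, in the crux workfile `TameCensorship/NullTerminalityUniformity` (Summits side) and needed,
for an arbitrary spacelike graph `y ↦ (u(y), y)` in Minkowski space-time, by the family of Cauchy
developments inhabiting the conclusion of the rigid positive energy theorem
(`positive_mass_rigidity_spacetime`, Beig–Chruściel 1996, Thm. 4.1; see
`SpacelikeGraphMinkowski.lean`). Theorems only; no definition, no named fact:

* `ModelSpace.mdifferentiableAt_lift_iff` — the lift `x ↦ (f x, ν x) ∈ TF` is differentiable at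
  `y` iff `f` and `x ↦ ν x ∈ F` are (trivial tangent bundle of the model space);
* `ModelSpace.normalDerivAlong_eq_mfderiv` — **`D_v ν = d(ν)_y v`**: for `g` with constant
  components, `f : N → F` and `ν` differentiable at an interior point `y`,
  `g.normalDerivAlong f ν y v = mfderiv (x ↦ ν x) y v` (frame formula `normalDerivAlong_eq` in the
  constant coordinate frame, whose coefficient functionals are the constant coordinate
  functionals and whose covariant derivatives vanish);
* `ModelSpace.secondFundamentalForm_eq_mfderiv` — **`K_ν(v, w) = G₀(dν_y v, df_y w)`**
  (`secondFundamentalForm_apply_holds`).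

## References

* B. O'Neill, *Semi-Riemannian geometry*, Academic Press 1983, Ch. 3, Lemma 3.14 (natural
  coordinates of `ℝⁿᵥ` are parallel); Ch. 4, Lemma 4.1, Cor. 4.2 and pp. 98–100 (`D̄_V X` along a
  submanifold, the shape tensor). [ONeill1983]
* R. M. Wald, *General Relativity*, Chicago 1984, §10.2, (10.2.13) (`K_ab = h_a{}^c ∇_c n_b`).
  [Wald1984]
-/

noncomputable section

open Bundle Set Function Manifold
open scoped Manifold ContDiff Topology

namespace Literature.Geometry.Lorentzian

namespace ModelSpace

variable {F : Type*} [NormedAddCommGroup F] [NormedSpace ℝ F] [FiniteDimensional ℝ F]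
  {E' : Type*} [NormedAddCommGroup E'] [NormedSpace ℝ E'] {H' : Type*} [TopologicalSpace H']
  {I' : ModelWithCorners ℝ E' H'} {N : Type*} [TopologicalSpace N] [ChartedSpace H' N]
  {n : ℕ∞ω} {g : PseudoRiemannianMetric 𝓘(ℝ, F) n F (TangentSpace 𝓘(ℝ, F) : F → Type _)}
  {G₀ : F →L[ℝ] F →L[ℝ] ℝ}

omit [FiniteDimensional ℝ F] in
/-- **The lift of a field along a map into the model space is differentiable iff the map and the
field are**: the tangent bundle of the model space `F` is trivial, its preferred trivialisations
are the identity (`trivializationAt_model_space_apply`), so `x ↦ (f x, ν x) ∈ TF` is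
differentiable at `y` iff `f` and `x ↦ ν x ∈ F` are (Mathlib's `mdifferentiableAt_totalSpace`).
[folklore] -/
theorem mdifferentiableAt_lift_iff {f : N → F} {ν : NormalField 𝓘(ℝ, F) f} {y : N} :
    MDifferentiableAt I' 𝓘(ℝ, F).tangent
        (fun x ↦ (TotalSpace.mk' F (f x) (ν x) : TangentBundle 𝓘(ℝ, F) F)) y ↔
      MDifferentiableAt I' 𝓘(ℝ, F) f y ∧ MDifferentiableAt I' 𝓘(ℝ, F) (fun x ↦ (ν x : F)) y := by
  rw [mdifferentiableAt_totalSpace]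
  simp only [trivializationAt_model_space_apply]

variable [g.HasLeviCivita]

/-- **`D_v ν = dν_y(v)` along a map into a flat model space.** Let `g` be a pseudo-Riemannian
metric with constant components `G₀` on the normed space `F`, `f : N → F` a map and `ν` a field
along `f` (`ν x ∈ T_{f x} F = F`), both differentiable at the interior point `y` of `N`. Then the
covariant derivative of `ν` in the direction `v ∈ T_y N` (the tree's `normalDerivAlong`, built on
the covariant derivative along chart-straight curves) is the ordinary differential of `x ↦ ν x`
at `y` applied to `v`. Proof: in the frame formula `normalDerivAlong_eq`
(`D_v ν = ∑ᵢ d(cⁱ(ν))_y(v) bᵢ + ∑ᵢ cⁱ(ν y) ∇_{df v} bᵢ` for the coordinate frame `bᵢ` of the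
identity trivialisation) the coefficient functionals `cⁱ` are the constant coordinate functionals
of the basis (`localFrame_coeff_trivializationAt`) and `∇_{df v} bᵢ = 0` (`leviCivita_const`), so
the right-hand side is `∑ᵢ bⁱ(dν_y v) bᵢ = dν_y v`. O'Neill 1983, Ch. 4, Lemma 4.1 with Ch. 3,
Lemma 3.14 (in natural coordinates of `ℝⁿᵥ`, `D̄_V X = ∑ V(Xⁱ) ∂ᵢ`).
[cite: ONeill1983, Ch. 4, Lemma 4.1 and Ch. 3, Lemma 3.14] -/
theorem normalDerivAlong_eq_mfderiv [IsManifold I' ∞ N] (hG : ∀ y : F, g.val y = G₀) {f : N → F}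
    {ν : NormalField 𝓘(ℝ, F) f} {y : N} (hy : I'.IsInteriorPoint y)
    (hf : MDifferentiableAt I' 𝓘(ℝ, F) f y)
    (hν : MDifferentiableAt I' 𝓘(ℝ, F) (fun x ↦ (ν x : F)) y) (v : TangentSpace I' y) :
    g.normalDerivAlong f ν y v = mfderiv I' 𝓘(ℝ, F) (fun x ↦ (ν x : F)) y v := by
  have hlift : MDifferentiableAt I' 𝓘(ℝ, F).tangent
      (fun x ↦ (TotalSpace.mk' F (f x) (ν x) : TangentBundle 𝓘(ℝ, F) F)) y :=
    mdifferentiableAt_lift_iff.mpr ⟨hf, hν⟩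
  rw [PseudoRiemannianMetric.normalDerivAlong_eq g (I' := I') hy hlift v]
  set b := Module.finBasis ℝ F with hb
  set w : F := mfderiv I' 𝓘(ℝ, F) (fun x ↦ (ν x : F)) y v with hw
  -- the coefficient functionals are the constant coordinate functionals `bⁱ`
  have h1 : ∀ i, (show ℝ from mfderiv I' 𝓘(ℝ, ℝ) (fun x ↦
      (trivializationAt F (TangentSpace 𝓘(ℝ, F) : F → Type _) (f y)).localFrame_coeff
        𝓘(ℝ, F) b i (f x) (ν x)) y v) = b.repr w i := by
    intro i
    set L : F →L[ℝ] ℝ := LinearMap.toContinuousLinearMap (b.coord i) with hL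
    have hrep : (fun x ↦ (trivializationAt F (TangentSpace 𝓘(ℝ, F) : F → Type _)
        (f y)).localFrame_coeff 𝓘(ℝ, F) b i (f x) (ν x)) = L ∘ fun x ↦ (ν x : F) := by
      funext x
      rw [Function.comp_apply, localFrame_coeff_trivializationAt]
      rfl
    rw [hrep, mfderiv_comp y L.mdifferentiableAt hν, ContinuousLinearMap.mfderiv_eq]
    rfl
  -- the frame is constant and parallel
  have h2 : ∀ i, (trivializationAt F (TangentSpace 𝓘(ℝ, F) : F → Type _) (f y)).localFrame
      b i (f y) = b i := fun i ↦ by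
    rw [localFrame_trivializationAt]
  have h3 : ∀ i, g.leviCivita ((trivializationAt F
      (TangentSpace 𝓘(ℝ, F) : F → Type _) (f y)).localFrame b i) (f y)
        (mfderiv I' 𝓘(ℝ, F) f y v) = 0 := fun i ↦ by
    rw [localFrame_trivializationAt, leviCivita_const (g := g) hG (f y) (b i)]
    rfl
  refine Eq.trans (b := ∑ i, (b.repr w i) • (b i : F) + ∑ _i : Fin (Module.finrank ℝ F), (0 : F))
    ?_ ?_
  · congr 1
    · refine Finset.sum_congr rfl fun i _ ↦ ?_
      rw [h2 i]
      exact congrArg (fun c : ℝ ↦ c • (b i : F)) (h1 i)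
    · refine Finset.sum_congr rfl fun i _ ↦ ?_
      rw [h3 i, smul_zero]
      rfl
  · rw [b.sum_repr, Finset.sum_const_zero, add_zero]

/-- **The second fundamental form along a map into a flat model space is `G₀(dν v, df w)`.** Under
the hypotheses of `normalDerivAlong_eq_mfderiv` (and a finite-dimensional source model, for the
tree's `secondFundamentalForm_apply_holds`): for all `v, w ∈ T_y N`,
`K_ν(v, w) = G₀(d(ν)_y v, df_y w)` — the sign convention `K_ν(v, w) = + g(D_v ν, df w)` of
`Hypersurface.lean`. Wald 1984, §10.2, (10.2.13); O'Neill 1983, Ch. 4, Lemma 4.1 and p. 100.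
[cite: Wald1984, §10.2 (10.2.13)] -/
theorem secondFundamentalForm_eq_mfderiv [IsManifold I' ∞ N] [FiniteDimensional ℝ E']
    (hG : ∀ y : F, g.val y = G₀) {f : N → F} {ν : NormalField 𝓘(ℝ, F) f} {y : N}
    (hy : I'.IsInteriorPoint y) (hf : MDifferentiableAt I' 𝓘(ℝ, F) f y)
    (hν : MDifferentiableAt I' 𝓘(ℝ, F) (fun x ↦ (ν x : F)) y) (v w : TangentSpace I' y) :
    g.secondFundamentalForm I' f ν y v w =
      G₀ (mfderiv I' 𝓘(ℝ, F) (fun x ↦ (ν x : F)) y v) (mfderiv I' 𝓘(ℝ, F) f y w) := by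
  have hlift : MDifferentiableAt I' 𝓘(ℝ, F).tangent
      (fun x ↦ (TotalSpace.mk' F (f x) (ν x) : TangentBundle 𝓘(ℝ, F) F)) y :=
    mdifferentiableAt_lift_iff.mpr ⟨hf, hν⟩
  rw [PseudoRiemannianMetric.secondFundamentalForm_apply_holds (g := g) (I' := I') hy hlift v w,
    normalDerivAlong_eq_mfderiv hG hy hf hν v, hG (f y)]
  rfl

end ModelSpace

end Literature.Geometry.Lorentzian

end
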